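import Literature.MathematicalPhysics.QuantumFieldTheory.Balaban1983to89.B9SectBGWordCurlHolY
import Literature.MathematicalPhysics.QuantumFieldTheory.Balaban1983to89.B9Eq310Hermitian

/-!
# Balaban [B9], (3.9)–(3.10) p. 392 — NODE 00's co-curl `D*_U` on plaquette functions (`coCurlY`) IS pv27's `divP` IN COORDINATES, and THE FIRST TERM
# `D*_U ∘ 𝒦_U ∘ D_U` OF NODE 00's HESSIAN IS pv27's `D*_ηD_η + D*(½{D·, z})`: `coCurlY_eq_divP`, ★ `coCurlY_jordanY_curlY_eq` (pub-ymgap N06 G-side plan,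
# Route L, bricks of L-3)

T. Bałaban, *Propagators for lattice gauge theories in a background field*, Commun. Math. Phys. **99** (1985) 389–434
[`Balaban1985BackgroundPropagators`, "B9"].

statement-level skeleton of published theorems with citation tags; proofs where landed; nothing here is a claim about the
Yang–Mills mass gap

THE PRINTED LOCI.  (3.9) p. 392 (the adjoint `D*` on plaquette functions, «first form» `(D*F)_μ(x) = Σ_{ν<μ}(D*_νF_{νμ})(x) − Σ_{ν>μ}(D*_νF_{μν})(x)`); (3.10)
p. 392 (`⟨A, ΔA⟩ = ⟨A, D*DA⟩ + ⟨A, Δ′A⟩`, first term of `Δ′`: `Σ_p tr((DA)(p))²η⁻²(Re U(∂p) − 1)`).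

WHY THIS FILE (seat dag-n06-c gen 13; G-SIDE-PLAN v2, Route L, L-3).  Continuing `B9SectBGWordCurlHolY`: (i) `coCurlY_eq_divP` — at the bond `⟨x, ν⟩`, NODE 00's
`coCurlY U F` IS `c_f • divP (shiftY) (UboxY U) F̂ ν (chart x)` with `F̂ μ ν z := extP F μ ν z` (def-Y's one-sided reading `F_{μν}`, `μ < ν`, of a plaquette
function; `B9Eq3104CommutatorGradFormCurl.coCurlY_apply_eq`); (ii) ★ `coCurlY_jordanY_curlY_eq` — the first term of NODE 00's Hessian at a bond,
`(D*_U 𝒦_U D_U Λ)⟨x, ν⟩ = (divPη η (curlη η F) + divP (jordanF η F)) ν (chart x)` with pv27's letters of `B9Eq310Hermitian` (`jordanF = ½(D F·z + z·D F)`,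
`z = η⁻²(Re U(∂p) − 1)`), `F κ z := bondFunCoordsY Λ (κ, z)`, `η := |c_f|⁻¹` — because `½{c_f D F, Re} ∙ c_f = η⁻²·D F + ½{D F, η⁻²(Re − 1)}` (`c_f² = η⁻²`).
So NODE 00's `coCurlY ∘ jordanY ∘ curlY` IS pv27's `D*_ηD_η + (first term of Δ′)`; the commutator term `curv2Y` versus `divL (commG₁…₄)` is the remaining
brick of L-3 (next file).

HONEST SCOPE.  Exact identities between DEFINED objects; no estimate; nothing of [B9] asserted; count-neutral; N06 NOT discharged; nothing continuum ∕ OS ∕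
mass-gap ∕ Clay.  No `sorry`, no `axiom`, no `def`, no `instance`.  `--supports stmt-QuantumFields-27364`.

RELATED IN THE TREE, NOT DUPLICATED: `B9Eq3104CommutatorGradFormCurl` (def-Y: `coCurlY_apply_eq`, `extP`, `extP_curlY`, `extP_jordanY` — USED), `B9SectBGWordCurlHolY`
(gen 13: `curlY_eq_curl`, `reHolY_eq_reC`, `cdB_apply_eq_covD` — USED), `B9Eq310Hermitian` ∕ `B9Eq39Adjoint` (pv27's `divP`, `divPη`, `curlη`, `jordanF`, `zP` — USED).
-/

noncomputable section

namespace Literature.MathematicalPhysics.QuantumFieldTheory.Balaban1983to89.B9SectBGWordCoCurlY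

open Literature.MathematicalPhysics.QuantumFieldTheory.Balaban1983to89
open Literature.MathematicalPhysics.QuantumFieldTheory.Balaban1983to89.B6KLevelCensusIndexV1 (KIdx)
open Literature.MathematicalPhysics.QuantumFieldTheory.Balaban1983to89.B9Eq39Adjoint (R covD covDstar curl plaqU divP divPη curlη covDstar_zero covDstar_smul
  curl_smul divP_smul)
open Literature.MathematicalPhysics.QuantumFieldTheory.Balaban1983to89.B9Eq37Insertion (reC)
open Literature.MathematicalPhysics.QuantumFieldTheory.Balaban1983to89.B9Eq310Hermitian (jordanF zP divP_add)
open Literature.MathematicalPhysics.QuantumFieldTheory.Balaban1983to89.B9Eq3104CommutatorGradFormCurl (coCurlY_apply_eq extP extP_chartY extP_curlY extP_jordanY)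
open Literature.MathematicalPhysics.QuantumFieldTheory.Balaban1983to89.B9SectBGWordGradDivY (cdsS_eq_covDstar)
open Literature.MathematicalPhysics.QuantumFieldTheory.Balaban1983to89.B9SectBGWordCurlHolY (curlY_eq_curl reHolY_eq_reC cdB_apply_eq_covD UboxY_chartY)
open Literature.MathematicalPhysics.QuantumFieldTheory.Balaban1983to89.Node00 (SiteY FBondY PlaqY CfgY UboxY shiftY cdB cdsS curlY coCurlY jordanY holY reHolY
  bondCoordsY bondFunCoordsY bondFunCoordsY_apply)
open Literature.MathematicalPhysics.QuantumFieldTheory.Balaban1983to89.Node00.OpsYNablaBridge (chartY chartY_eq shiftY_chartY)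

variable {𝔸 : Type} [NormedRing 𝔸] [NormedAlgebra ℂ 𝔸] [CompleteSpace 𝔸]
variable {d ℓ : ℕ} {hd : 1 ≤ d + 1} {hL : Odd (ℓ + 1) ∧ 1 < ℓ + 1} {b₀ b₁ : ℝ}
variable (i : KIdx d ℓ hd hL b₀ b₁)

omit [NormedAlgebra ℂ 𝔸] [CompleteSpace 𝔸] in
/-- def-Y's one-sided reading vanishes off `μ < ν`. [cite: Balaban1985BackgroundPropagators, (3.4) p.391, bookkeeping] -/
theorem extP_of_not_lt (F : PlaqY i → 𝔸) {μ ν : Fin (d + 1)} (h : ¬ μ < ν) : extP i F μ ν = 0 := by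
  funext z
  unfold extP
  rw [dif_neg h]
  rfl

/-- ★ **(3.9) — NODE 00's co-curl IS pv27's `divP` in coordinates**: at the bond `⟨x, ν⟩`,
`(D*_U F)⟨x, ν⟩ = c_f • divP (shiftY) (UboxY U) (extP F) ν (chart x)`. [cite: Balaban1985BackgroundPropagators, (3.9) p.392] -/
theorem coCurlY_eq_divP (U : CfgY 𝔸 i) (F : PlaqY i → 𝔸) (x : Site (B6GlobalChartV1.PV d ℓ i.m i.K hd hL) 0) (ν : Fin (d + 1)) :
    coCurlY i U F ⟨x, ν⟩ = ((i.cf : ℝ) : ℂ) • divP (shiftY i) (UboxY i U) (fun μ ν z => extP i F μ ν z) ν (chartY i x) := by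
  rw [coCurlY_apply_eq]
  congr 1
  rw [divP, ← Finset.sum_sub_distrib]
  refine Finset.sum_congr rfl fun μ _ => ?_
  rw [cdsS_eq_covDstar, cdsS_eq_covDstar]
  by_cases h1 : μ < ν
  · have h2 : ¬ ν < μ := fun h => lt_asymm h1 h
    rw [if_pos h1, if_neg h2, extP_of_not_lt i F h2, covDstar_zero]
  · by_cases h2 : ν < μ
    · rw [if_neg h1, if_pos h2, extP_of_not_lt i F h1, covDstar_zero]
    · rw [if_neg h1, if_neg h2, extP_of_not_lt i F h1, extP_of_not_lt i F h2, covDstar_zero]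

/-- `c_f² = η⁻²` for the member's units `η = |c_f|⁻¹`. [cite: Balaban1985BackgroundPropagators, (3.1) p.390, bookkeeping] -/
theorem cf_sq_eq (i : KIdx d ℓ hd hL b₀ b₁) : ((i.cf : ℝ) : ℂ) ^ 2 = ((((|i.cf|⁻¹ : ℝ) : ℝ) : ℂ)⁻¹) ^ 2 := by
  rw [← Complex.ofReal_inv, inv_inv, ← Complex.ofReal_pow, ← Complex.ofReal_pow, sq_abs]

/-- the plaquette reading of `𝒦_U(D_U Λ)` in pv27's letters: for `μ < ν`,
`extP (jordanY U (curlY U Λ)) μ ν z = c_f • ½(curl F μ ν z · Re + Re · curl F μ ν z)`, `Re = reC (plaqU … μ ν z)`. [cite: Balaban1985BackgroundPropagators, (3.10) p.392] -/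
theorem extP_jordanY_curlY (U : CfgY 𝔸 i) (Λ : FBondY i → 𝔸) (μ ν : Fin (d + 1)) (z : SiteY i) :
    extP i (jordanY i U (curlY i U Λ)) μ ν z =
      if μ < ν then ((i.cf : ℝ) : ℂ) • ((1 / 2 : ℂ) •
        (curl (shiftY i) (UboxY i U) (fun κ w => bondFunCoordsY i Λ (κ, w)) μ ν z * reC (plaqU (shiftY i) (UboxY i U) μ ν z) +
          reC (plaqU (shiftY i) (UboxY i U) μ ν z) * curl (shiftY i) (UboxY i U) (fun κ w => bondFunCoordsY i Λ (κ, w)) μ ν z)) else 0 := by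
  obtain ⟨x, rfl⟩ := (chartY i).surjective z
  rw [extP_jordanY]
  by_cases h : μ < ν
  · rw [dif_pos h, if_pos h, extP_chartY, dif_pos h, Equiv.symm_apply_apply, LinearMap.smul_apply, LinearMap.add_apply, LinearMap.mulRight_apply,
      LinearMap.mulLeft_apply]
    have hc : curlY i U Λ ⟨x, μ, ν, h⟩ = ((i.cf : ℝ) : ℂ) • curl (shiftY i) (UboxY i U) (fun κ w => bondFunCoordsY i Λ (κ, w)) μ ν (chartY i x) :=
      curlY_eq_curl i U Λ ⟨x, μ, ν, h⟩
    have hr : reHolY i U ⟨x, μ, ν, h⟩ = reC (plaqU (shiftY i) (UboxY i U) μ ν (chartY i x)) := reHolY_eq_reC i U ⟨x, μ, ν, h⟩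
    rw [hc, hr, smul_mul_assoc, mul_smul_comm, ← smul_add, smul_comm]
  · rw [dif_neg h, if_neg h, LinearMap.zero_apply]

omit [NormedAlgebra ℂ 𝔸] [CompleteSpace 𝔸] in
/-- `divP` reads a plaquette function only at ordered pairs `μ < ν` («first form» of (3.9)). [cite: Balaban1985BackgroundPropagators, (3.9) p.392, bookkeeping] -/
theorem divP_congr_of_lt {S : Type} {ι' : Type} [Fintype ι'] [LinearOrder ι'] (T : ι' → Equiv.Perm S) (V : ι' → S → 𝔸ˣ)
    {G H : ι' → ι' → S → 𝔸} (h : ∀ μ ν, μ < ν → G μ ν = H μ ν) (μ : ι') (x : S) : divP T V G μ x = divP T V H μ x := by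
  unfold divP
  congr 1
  · refine Finset.sum_congr rfl fun ν _ => ?_
    split_ifs with hlt
    · rw [h ν μ hlt]
    · rfl
  · refine Finset.sum_congr rfl fun ν _ => ?_
    split_ifs with hlt
    · rw [h μ ν hlt]
    · rfl

/-- ★ **THE FIRST TERM OF NODE 00's HESSIAN IS pv27's `D*_ηD_η + D*(½{D·, z})`**: at the bond `⟨x, ν⟩`, with `F κ w := bondFunCoordsY Λ (κ, w)` and
`η := |c_f|⁻¹`, `(coCurlY U ∘ jordanY U ∘ curlY U) Λ ⟨x, ν⟩ = (divPη η (curlη η F) + divP (jordanF η F)) ν (chart x)` (pv27's letters along `shiftY`, `UboxY U`)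
— the `Re` versus `Re − 1` bookkeeping: `c_f²·D*(½{DF, Re}) = η⁻²D*D F + D*(½{DF, η⁻²(Re − 1)})`.
[cite: Balaban1985BackgroundPropagators, (3.10) p.392] -/
theorem coCurlY_jordanY_curlY_eq (U : CfgY 𝔸 i) (Λ : FBondY i → 𝔸) (x : Site (B6GlobalChartV1.PV d ℓ i.m i.K hd hL) 0) (ν : Fin (d + 1)) :
    (coCurlY i U ∘ₗ jordanY i U ∘ₗ curlY i U) Λ ⟨x, ν⟩ =
      divPη (shiftY i) (UboxY i U) (|i.cf|⁻¹) (curlη (shiftY i) (UboxY i U) (|i.cf|⁻¹) (fun κ w => bondFunCoordsY i Λ (κ, w))) ν (chartY i x) +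
        divP (shiftY i) (UboxY i U) (jordanF (shiftY i) (UboxY i U) (|i.cf|⁻¹) (fun κ w => bondFunCoordsY i Λ (κ, w))) ν (chartY i x) := by
  have hη : ((|i.cf|⁻¹ : ℝ) : ℂ)⁻¹ = ((|i.cf| : ℝ) : ℂ) := by rw [Complex.ofReal_inv, inv_inv]
  have hcf2 : ((i.cf : ℝ) : ℂ) * ((i.cf : ℝ) : ℂ) = ((|i.cf| : ℝ) : ℂ) * ((|i.cf| : ℝ) : ℂ) := by
    rw [← Complex.ofReal_mul, ← Complex.ofReal_mul, ← sq, ← sq, sq_abs]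
  -- both sides as ONE `divP`
  have hcurlη : curlη (shiftY i) (UboxY i U) (|i.cf|⁻¹) (fun κ w => bondFunCoordsY i Λ (κ, w)) =
      ((|i.cf| : ℝ) : ℂ) • curl (shiftY i) (UboxY i U) (fun κ w => bondFunCoordsY i Λ (κ, w)) := by
    funext μ ν' z
    rw [curlη, hη]
    rfl
  rw [LinearMap.comp_apply, LinearMap.comp_apply, coCurlY_eq_divP, ← divP_smul, divPη, hη, ← divP_smul, hcurlη, ← divP_add]
  refine divP_congr_of_lt (shiftY i) (UboxY i U) (fun μ ν' hlt => funext fun z => ?_) ν (chartY i x)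
  -- pointwise on `μ < ν′`: `c_f • extP (𝒦_U(D_UΛ)) μ ν′ z = |c_f| • |c_f| • curl F + jordanF F`
  show ((i.cf : ℝ) : ℂ) • extP i (jordanY i U (curlY i U Λ)) μ ν' z =
    ((|i.cf| : ℝ) : ℂ) • (((|i.cf| : ℝ) : ℂ) • curl (shiftY i) (UboxY i U) (fun κ w => bondFunCoordsY i Λ (κ, w)) μ ν' z) +
      jordanF (shiftY i) (UboxY i U) (|i.cf|⁻¹) (fun κ w => bondFunCoordsY i Λ (κ, w)) μ ν' z
  rw [extP_jordanY_curlY, if_pos hlt, jordanF, zP, hη, one_div]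
  set X := curl (shiftY i) (UboxY i U) (fun κ w => bondFunCoordsY i Λ (κ, w)) μ ν' z
  set Rr := reC (plaqU (shiftY i) (UboxY i U) μ ν' z)
  set a : ℂ := ((|i.cf| : ℝ) : ℂ)
  rw [smul_smul, hcf2, sq]
  simp only [smul_sub, smul_add, mul_sub, sub_mul, mul_smul_comm, smul_mul_assoc, mul_one, one_mul, smul_smul]
  module

end Literature.MathematicalPhysics.QuantumFieldTheory.Balaban1983to89.B9SectBGWordCoCurlY

end
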